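import Summits.KontsevichZagierPeriods.KontsevichZagierPeriods.Theorems.UnfoldedStokesDefs
import Literature.NumberTheory.Transcendental.KZProductIdeal

/-!
# `StokesGeneration` (stmt-KontsevichZagierPeriods-3586) — line `fibrewise_stokes`, stub `fibStokesDecomposable_congr_off_null`

Closure of the class of FIBREWISE-STOKES DECOMPOSABLE functions (`FibStokesDecomposable M h`, the package of the
residual S2 of the line, `Theorems/UnfoldedStokesDefs.lean`) under agreement off a null `ℚ`-semialgebraic set: if
`h₁ = h₂` on the closed unit cube `[0,1]^M` off a `ℚ`-semialgebraic Lebesgue-null set `Z ⊆ ℝ^M` and `h₁` is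
decomposable, so is `h₂`. The decomposition of `h₁` (padding dimension `M'`, elements, carried representations) is
kept verbatim; only its exceptional null set `Z'` is enlarged to `Z' ∪ C` with the cylinder
`C = {x ∈ ℝ^{M'} | pr x ∈ Z}` over `Z` (`pr` the projection to the first `M` coordinates), which is `ℚ`-semialgebraic
(a coordinate preimage, [BCR 1998, §2.1]) and null (`vol C = vol Z · vol ℝ^{M'−M} = 0`, Fubini along `Fin.append`,
`KZ.volume_cylinder`). Pure bookkeeping; no analysis.

References: J. Ayoub, Ann. of Math. 181 (2015), Rem. 1.5; J. Bochnak, M. Coste, M.-F. Roy, *Real Algebraic Geometry*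
(1998), §2.1; M. Kontsevich, D. Zagier, *Periods* (2001), §1.2 (rule (1): integrands may be changed on null sets).
-/

noncomputable section

-- `Summit.KontsevichZagierPeriods.KontsevichZagierPeriods.…` is the tree's mandated layout (single-conjunct summit).
set_option linter.dupNamespace false

namespace Summit.KontsevichZagierPeriods.KontsevichZagierPeriods.Cruxes.StokesGeneration.FibrewiseStokes

open MeasureTheory Set
open Literature.NumberTheory.Transcendental
open Literature.NumberTheory.Transcendental.KZ
open Literature.ModelTheory.ExponentialFields (IsSemialgebraic)

/-- The cylinder `{x ∈ ℝ^{M'} | pr x ∈ Z}` over a Lebesgue-null set `Z ⊆ ℝ^M` of the first `M` coordinates is null: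
after writing `M' = M + d` it is the cylinder `Z × ℝ^d` of `KZ.volume_cylinder`, of volume `vol Z · vol ℝ^d = 0`.
[folklore] -/
private theorem volume_setOf_castLE_mem_null {M M' : ℕ} (h : M ≤ M') {Z : Set (Fin M → ℝ)}
    (hZ : volume Z = 0) : volume {x : Fin M' → ℝ | (fun l => x (Fin.castLE h l)) ∈ Z} = 0 := by
  obtain ⟨d, rfl⟩ := Nat.exists_eq_add_of_le h
  have hset : {x : Fin (M + d) → ℝ | (fun l => x (Fin.castLE h l)) ∈ Z} =
      {z : Fin (M + d) → ℝ | (fun i => z (Fin.castAdd d i)) ∈ Z ∧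
        (fun j => z (Fin.natAdd M j)) ∈ (Set.univ : Set (Fin d → ℝ))} := by
    ext x
    simp only [Set.mem_setOf_eq, Set.mem_univ, and_true]
    exact Iff.rfl
  rw [hset, volume_cylinder, hZ, zero_mul]

/-- The cylinder `{x ∈ ℝ^{M'} | pr x ∈ Z}` over a `ℚ`-semialgebraic set `Z ⊆ ℝ^M` of the first `M` coordinates is
`ℚ`-semialgebraic (a coordinate preimage; no Tarski–Seidenberg). [BCR 1998, §2.1] [cite: BochnakCosteRoy1998, §2.1] -/
private theorem isSemialgebraic_setOf_castLE_mem {M M' : ℕ} (h : M ≤ M') {Z : Set (Fin M → ℝ)}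
    (hZ : IsSemialgebraic ℚ Z) : IsSemialgebraic ℚ {x : Fin M' → ℝ | (fun l => x (Fin.castLE h l)) ∈ Z} :=
  hZ.preimage_comp (Fin.castLE h)

/-- **Agreement off a null semialgebraic set (registered stub `fibStokesDecomposable_congr_off_null`).** If `h₁ = h₂`
on the closed unit cube off a `ℚ`-semialgebraic null set `Z` and `h₁` is fibrewise-Stokes decomposable, so is `h₂`:
keep the decomposition of `h₁` and enlarge its exceptional null set `Z'` to `Z' ∪ {x | pr x ∈ Z}` (semialgebraic
coordinate preimage, null cylinder). This is Kontsevich–Zagier's rule (1) freedom of changing an integrand on a null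
set, inside the S2 package. [folklore] -/
theorem fibStokesDecomposable_congr_off_null :
    ∀ (M : ℕ) (h₁ h₂ : (Fin M → ℝ) → ℝ) (Z : Set (Fin M → ℝ)), IsSemialgebraic ℚ Z → volume Z = 0 →
      (∀ x ∈ Set.pi Set.univ (fun _ : Fin M => Set.Icc (0:ℝ) 1), x ∉ Z → h₁ x = h₂ x) →
      FibStokesDecomposable M h₁ → FibStokesDecomposable M h₂ := by
  intro M h₁ h₂ Z hZ hZ0 hh ⟨M', hMM', J, i, G, D, K, q, Z', hpack, hq, hZ's, hZ'0, hid⟩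
  refine ⟨M', hMM', J, i, G, D, K, q, Z' ∪ {x : Fin M' → ℝ | (fun l => x (Fin.castLE hMM' l)) ∈ Z}, hpack, hq,
    hZ's.union (isSemialgebraic_setOf_castLE_mem hMM' hZ),
    measure_union_null hZ'0 (volume_setOf_castLE_mem_null hMM' hZ0), fun x hx hxU => ?_⟩
  rw [Set.mem_union, not_or] at hxU
  rw [← hid x hx hxU.1]
  exact (hh _ (fun l _ => hx _ (Set.mem_univ _)) hxU.2).symm

end Summit.KontsevichZagierPeriods.KontsevichZagierPeriods.Cruxes.StokesGeneration.FibrewiseStokes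

end
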